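import Summits.AtomisticToContinuum.Crystallization.Theorems.HullExactificationCascadeHcpLandscapeGapStubGoodOfNoBadBondHeights
import Literature.MathematicalPhysics.StatisticalMechanics.BarlowStackingHeights

/-!
# Crux `HcpLandscapeGap` (route `HullExactificationCascade`, stmt-AtomisticToContinuum-12087),
# line `birth`: stub `stub_goodOfDeepSite` (X2) — a deep window site with no bad bond and
# near-`h` spacings nearby is `Good(4, θ)`

In the lead's assembly `y : Fin n → ℝ³` enumerates the WINDOW `S ∩ B̄_L(c)` of the multilattice
`S = barlowStackingH a' H s` (hypothesis `Set.range y = {p | p ∈ S ∧ dist p c ≤ L}`), and the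
site `i` is `Good(4, θ)` iff for some linear isometry `A` (1) every hcp point `q` of norm `≤ 4`
has a window point `y j` within `θ` of `y i + A q`, and (2) every window point `y j` with
`dist (y j) (y i) ≤ 4` has `y i + A q`, `q` hcp, within `θ`.

This stub: a DEEP window site (`dist (y i) c ≤ L − 5`) with no cubic bond and `δ₁`-almost-`h`
spacings within `K` layers (and `|a' − a| ≤ δ₁`) is `Good(4, θ)`.

Proof.  Apply `stub_goodOfNoBadBondHeights a h _ _ (min θ (1/2))` (tolerance
`θ₁ = min θ (1/2) > 0`) to get `δ₁, K`, and keep them.  Its gap hypothesis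
`∀ k, h/2 ≤ H (k+1) − H k` follows from the band: `H (k+1) − H k ≥ 39 a'/50 ≥ 39·47/2500 > 1/2 ≥ h/2`
(`h ≤ 1`).  With `p = y i = barlowPosH a' H s k i' j'`: clause (1): for `q` hcp with `‖q‖ ≤ 4`
we get `z ∈ S` with `dist z p ≤ 4 + θ₁ ≤ 9/2` and `dist z (p + A₂ q) ≤ θ₁ ≤ θ`; then
`dist z c ≤ dist z p + dist p c ≤ 9/2 + L − 5 ≤ L`, so `z ∈ Set.range y`, i.e. `z = y j`.
Clause (2): for `j` with `dist (y j) (y i) ≤ 4`, `y j ∈ Set.range y ⊆ S`; apply clause (2) of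
the landed stub and `θ₁ ≤ θ`.  All `[folklore]`.
-/

noncomputable section

namespace Summit.AtomisticToContinuum.Crystallization.Theorems.HcpLandscapeGapBirth

open Literature.MathematicalPhysics.StatisticalMechanics

/-- **Stub X2 — a deep window site with no bad bond and near-`h` spacings nearby is
`Good(4, θ)`.**  For the reference scale `(a, h)` (`a, h > 0`, `h ≤ 1`) and `θ > 0` there are
`δ₁ > 0` and `K : ℕ` (those of `stub_goodOfNoBadBondHeights` at tolerance `min θ (1/2)`) such
that: for every in-layer scale `a' ∈ [47/50, 1]` with `|a' − a| ≤ δ₁`, every Hägg word `s`,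
every height profile `H` in the band `39 a'/50 ≤ H (k+1) − H k ≤ 17 a'/20`, every enumeration
`y : Fin n → ℝ³` of the window `barlowStackingH a' H s ∩ B̄_L(c)`, and every DEEP window site
`y i = barlowPosH a' H s k i' j'` (`dist (y i) c ≤ L − 5`) whose layers `k'` with `|k' − k| ≤ K`
carry no bad bond (`s (k'+1) ≠ s k'`) and only `δ₁`-almost-`h` spacings, the site `i` is
`Good(4, θ)`: some linear isometry `A` two-way `θ`-matches the radius-`4` window neighbourhood
of `y i` with `y i + A '' (hcpStacking a h ∩ B̄(0, 4))` (the band gives the gap `h/2`; the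
partners `z` of clause (1) have `dist z c ≤ (4 + 1/2) + (L − 5) ≤ L`, so lie in the window).
[folklore] -/
theorem stub_goodOfDeepSite : ∀ (a h : ℝ), 0 < a → 0 < h → h ≤ 1 → ∀ θ : ℝ, 0 < θ → ∃ δ₁ : ℝ, 0 < δ₁ ∧ ∃ K : ℕ, ∀ a' : ℝ, |a' - a| ≤ δ₁ → 47 / 50 ≤ a' → a' ≤ 1 → ∀ s : ℤ → ℤ, Literature.MathematicalPhysics.StatisticalMechanics.IsHaggSeq s → ∀ H : ℤ → ℝ, (∀ k : ℤ, 39 / 50 * a' ≤ H (k + 1) - H k ∧ H (k + 1) - H k ≤ 17 / 20 * a') → ∀ (c : EuclideanSpace ℝ (Fin 3)) (L : ℝ) (n : ℕ) (y : Fin n → EuclideanSpace ℝ (Fin 3)), Set.range y = {p : EuclideanSpace ℝ (Fin 3) | p ∈ Literature.MathematicalPhysics.StatisticalMechanics.barlowStackingH a' H s ∧ dist p c ≤ L} → ∀ (i : Fin n) (k i' j' : ℤ), y i = Literature.MathematicalPhysics.StatisticalMechanics.barlowPosH a' H s k i' j' → dist (y i) c ≤ L - 5 → (∀ k' : ℤ,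 |k' - k| ≤ K → s (k' + 1) ≠ s k') → (∀ k' : ℤ, |k' - k| ≤ K → |H (k' + 1) - H k' - h| ≤ δ₁) → ∃ A : EuclideanSpace ℝ (Fin 3) →ₗᵢ[ℝ] EuclideanSpace ℝ (Fin 3), (∀ q ∈ Literature.MathematicalPhysics.StatisticalMechanics.hcpStacking a h, ‖q‖ ≤ 4 → ∃ j : Fin n, dist (y j) (y i + A q) ≤ θ) ∧ (∀ j : Fin n, dist (y j) (y i) ≤ 4 → ∃ q ∈ Literature.MathematicalPhysics.StatisticalMechanics.hcpStacking a h, dist (y j) (y i + A q) ≤ θ) := by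
  intro a h ha hh hh1 θ hθ
  -- tolerance `θ₁ = min θ (1/2)` for the landed heights stub
  have hθ₁ : 0 < min θ (1 / 2) := lt_min hθ (by norm_num)
  obtain ⟨δ₁, hδ₁, K, hK⟩ := stub_goodOfNoBadBondHeights a h ha hh (min θ (1 / 2)) hθ₁
  refine ⟨δ₁, hδ₁, K, ?_⟩
  intro a' haδ ha1 _ha2 s hs H hband c L n y hy i k i' j' hyi hdeep hgood hH
  -- the band gives the gap `h/2`
  have hgap : ∀ k : ℤ, h / 2 ≤ H (k + 1) - H k := fun k => by
    have h1 := (hband k).1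
    nlinarith
  obtain ⟨A, hA1, hA2⟩ := hK a' haδ s hs H hgap k i' j' hgood hH
  rw [← hyi] at hA1 hA2
  have hθ₁θ : min θ (1 / 2) ≤ θ := min_le_left _ _
  have hθ₁2 : min θ (1 / 2) ≤ 1 / 2 := min_le_right _ _
  refine ⟨A, ?_, ?_⟩
  · -- clause (1): the partner `z` of an hcp point lies in the window, hence is some `y j`
    intro q hq hq4
    obtain ⟨z, hz, hz1, hz2⟩ := hA1 q hq hq4
    have hzc : dist z c ≤ L := by
      calc dist z c ≤ dist z (y i) + dist (y i) c := dist_triangle _ _ _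
        _ ≤ (4 + min θ (1 / 2)) + (L - 5) := add_le_add hz1 hdeep
        _ ≤ L := by linarith
    have hzr : z ∈ Set.range y := by
      rw [hy]
      exact ⟨hz, hzc⟩
    obtain ⟨j, rfl⟩ := hzr
    exact ⟨j, hz2.trans hθ₁θ⟩
  · -- clause (2): a window point `y j` is a multilattice point
    intro j hj
    have hyj : y j ∈ {p : EuclideanSpace ℝ (Fin 3) | p ∈ barlowStackingH a' H s ∧ dist p c ≤ L} := by
      rw [← hy]
      exact Set.mem_range_self j
    obtain ⟨q, hq, hqd⟩ := hA2 (y j) hyj.1 hj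
    exact ⟨q, hq, hqd.trans hθ₁θ⟩

end Summit.AtomisticToContinuum.Crystallization.Theorems.HcpLandscapeGapBirth

end
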